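import Mathlib
import HarnessLib
import Literature.Analysis.FluidPDE.KNSSSwirlSupNonpos
import Summits.NavierStokesRegularity.NavierStokesRegularity.Theorems.HalfSpaceWindowDoorCirculationCarryingRigiditySourcedSwirlSpaceTime

/-!
# Route `HalfSpaceWindowDoor`, crux `CirculationCarryingRigidity` (stmt-NavierStokesRegularity-25311) — the SOURCED SWIRL
# LIOUVILLE TOOL, part 3b: the space–time identity with source

For a sourced swirl triple (`…Defs.IsSourcedSwirl`): the extra-drift space–time integrand `B ∂ᵣF φ` is absolutely convergent on
`(0,T] × ℝ³` (`spaceTime_integrable_source`, dominated by `A‖∇F‖_∞ r⁻¹ 1_{cyl}`), and the tested, time-integrated sourced swirl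
equation gives (KNSS (5.15) = (5.17) + (5.19), Fubini, `time_identity`, `slice_identity`)
`∫∫ (F − M)∂ₛφ + ∫∫ [(F − M)(Dφ[V] + Δφ) + (2/r) F ∂ᵣφ − B ∂ᵣF φ] = 0` (`spaceTime_identity`).

Seat ns-hsw-p1 g3 (LEAD of 25311, cell pub-ns-dss).  WHAT THIS IS NOT: not a statement about Navier–Stokes regularity; a linear
parabolic Liouville tool (KNSS 2009 Thm 5.3 with an extra radial drift); helper `--supports` 25311.
-/

noncomputable section

-- the summit and its single sub-problem share the name (CONVENTIONS §1), as in every Theorems file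
set_option linter.dupNamespace false

namespace Summit.NavierStokesRegularity.NavierStokesRegularity.Theorems.HalfSpaceWindowDoorCirculationCarryingRigiditySourcedSwirlIdentity

open MeasureTheory Set Function Filter Topology TopologicalSpace InnerProductSpace WithLp Metric
open scoped Laplacian RealInnerProductSpace ContDiff
open Literature.Analysis Literature.Analysis.FluidPDE
open Summit.NavierStokesRegularity.NavierStokesRegularity.Theorems.HalfSpaceWindowDoorCirculationCarryingRigidityDefs
open Summit.NavierStokesRegularity.NavierStokesRegularity.Theorems.HalfSpaceWindowDoorCirculationCarryingRigiditySourcedSwirl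
open Summit.NavierStokesRegularity.NavierStokesRegularity.Theorems.HalfSpaceWindowDoorCirculationCarryingRigiditySourcedSwirlPlateau
open Summit.NavierStokesRegularity.NavierStokesRegularity.Theorems.HalfSpaceWindowDoorCirculationCarryingRigiditySourcedSwirlSpaceTime

open Summit.NavierStokesRegularity.NavierStokesRegularity.Theorems.HalfSpaceWindowDoorCirculationCarryingRigiditySourcedSwirl.IsSourcedSwirl
open Summit.NavierStokesRegularity.NavierStokesRegularity.Theorems.HalfSpaceWindowDoorCirculationCarryingRigiditySourcedSwirlPlateau.IsSourcedSwirl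
open Summit.NavierStokesRegularity.NavierStokesRegularity.Theorems.HalfSpaceWindowDoorCirculationCarryingRigiditySourcedSwirlSpaceTime.IsSourcedSwirl

namespace IsSourcedSwirl

variable {Cf Cu A τ' : ℝ} {F : ℝ → (EuclideanSpace ℝ (Fin 3)) → ℝ} {V : ℝ → (EuclideanSpace ℝ (Fin 3)) → (EuclideanSpace ℝ (Fin 3))}
  {B : ℝ → (EuclideanSpace ℝ (Fin 3)) → ℝ}

/-- **Absolute convergence of the extra-drift space–time integral**: on `(0,T] × ℝ³`, `T < τ'`, the integrand
`B ∂ᵣF φ` is integrable for the product measure (bounded by `A ‖∇F‖_∞ r⁻¹` on the cylinder carrying `φ`). -/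
theorem spaceTime_integrable_source (hP : IsSourcedSwirl Cf Cu A τ' F V B) {L T : ℝ} (hTτ : T < τ') :
    Integrable (fun p : ℝ × (EuclideanSpace ℝ (Fin 3)) => B p.1 p.2 * fderiv ℝ (F p.1) p.2 (eR p.2) * phiCut L T p.1 p.2)
      ((volume.restrict (Ioc 0 T)).prod volume) := by
  set μT : Measure (ℝ × (EuclideanSpace ℝ (Fin 3))) := (volume.restrict (Ioc 0 T)).prod volume with hμT
  have hμT' : μT = (volume.prod volume).restrict (Ioc 0 T ×ˢ univ) :=
    Measure.restrict_prod_eq_prod_univ _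
  have hslabm : MeasurableSet (Ioc (0 : ℝ) T ×ˢ (univ : Set (EuclideanSpace ℝ (Fin 3)))) :=
    measurableSet_Ioc.prod MeasurableSet.univ
  have hsub : Ioc (0 : ℝ) T ×ˢ (univ : Set (EuclideanSpace ℝ (Fin 3))) ⊆ Iio τ' ×ˢ univ :=
    fun p hp => ⟨lt_of_le_of_lt hp.1.2 hTτ, mem_univ _⟩
  have hτ : ∀ s ∈ Ioc (0 : ℝ) T, s < τ' := fun s hs => lt_of_le_of_lt hs.2 hTτ
  have hae : ∀ᵐ p ∂μT, p.1 ∈ Ioc 0 T ∧ cylRadius p.2 ≠ 0 := by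
    have h1 : ∀ᵐ p ∂μT, p ∈ Ioc (0 : ℝ) T ×ˢ (univ : Set (EuclideanSpace ℝ (Fin 3))) := by
      rw [hμT']; exact ae_restrict_mem hslabm
    have h2 : ∀ᵐ p ∂μT, cylRadius p.2 ≠ 0 :=
      (Measure.quasiMeasurePreserving_snd (μ := volume.restrict (Ioc (0 : ℝ) T))
        (ν := (volume : Measure (EuclideanSpace ℝ (Fin 3))))).ae ae_cylRadius_ne_zero
    filter_upwards [h1, h2] with p hp1 hp2
    exact ⟨hp1.1, hp2⟩
  have hAE_cont : ∀ {g : ℝ × (EuclideanSpace ℝ (Fin 3)) → ℝ}, ContinuousOn g (Iio τ' ×ˢ univ) →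
      AEStronglyMeasurable g μT := by
    intro g hg
    rw [hμT']
    exact (hg.mono hsub).aestronglyMeasurable hslabm
  have happly : Continuous fun q : ((EuclideanSpace ℝ (Fin 3)) →L[ℝ] ℝ) × (EuclideanSpace ℝ (Fin 3)) => q.1 q.2 :=
    (isBoundedBilinearMap_apply (𝕜 := ℝ) (E := EuclideanSpace ℝ (Fin 3)) (F := ℝ)).continuous
  have hAE_DF : ∀ {v : ℝ × (EuclideanSpace ℝ (Fin 3)) → (EuclideanSpace ℝ (Fin 3))}, Measurable v →
      AEStronglyMeasurable (fun p : ℝ × (EuclideanSpace ℝ (Fin 3)) => fderiv ℝ (F p.1) p.2 (v p)) μT := by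
    intro v hv
    have h1 : AEStronglyMeasurable (fun p : ℝ × (EuclideanSpace ℝ (Fin 3)) => fderiv ℝ (F p.1) p.2) μT := by
      rw [hμT']
      exact (hP.continuousOn_fderiv.mono hsub).aestronglyMeasurable hslabm
    exact happly.comp_aestronglyMeasurable (h1.prodMk hv.aestronglyMeasurable)
  have hVm : Measurable fun p : ℝ × (EuclideanSpace ℝ (Fin 3)) => V p.1 p.2 := hP.measurable_drift
  have hBm : Measurable fun p : ℝ × (EuclideanSpace ℝ (Fin 3)) => B p.1 p.2 := hP.measurable_beta
  have heRm : Measurable fun p : ℝ × (EuclideanSpace ℝ (Fin 3)) => eR p.2 := measurable_eR.comp measurable_snd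
  have hζ'c : Continuous (deriv (zetaCut T)) := (contDiff_zetaCut T (n := 2)).continuous_deriv (by norm_num)
  have hψc : Continuous (psiCut L) := (contDiff_psiCut L (n := 0)).continuous
  have hDφc : Continuous fun p : ℝ × (EuclideanSpace ℝ (Fin 3)) => fderiv ℝ (phiCut L T p.1) p.2 := by
    have h : Continuous fun p : ℝ × (EuclideanSpace ℝ (Fin 3)) => zetaCut T p.1 • fderiv ℝ (psiCut L) p.2 :=
      ((contDiff_zetaCut T (n := 0)).continuous.comp continuous_fst).smul
        (((contDiff_psiCut L (n := 1)).continuous_fderiv one_ne_zero).comp continuous_snd)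
    exact h.congr fun p => (fderiv_phiCut_eq L T p.1 p.2).symm
  have hΔφc : Continuous fun p : ℝ × (EuclideanSpace ℝ (Fin 3)) => (Δ (phiCut L T p.1)) p.2 := by
    have h : Continuous fun p : ℝ × (EuclideanSpace ℝ (Fin 3)) => zetaCut T p.1 * (Δ (psiCut L)) p.2 :=
      ((contDiff_zetaCut T (n := 0)).continuous.comp continuous_fst).mul
        ((continuous_laplacian (contDiff_psiCut L (n := 2))).comp continuous_snd)
    exact h.congr fun p => (laplacian_phiCut_eq L T p.1 p.2).symm
  have hφc : Continuous fun p : ℝ × (EuclideanSpace ℝ (Fin 3)) => phiCut L T p.1 p.2 :=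
    (hψc.comp continuous_snd).mul ((contDiff_zetaCut T (n := 0)).continuous.comp continuous_fst)
  have hm5 : AEStronglyMeasurable (fun p : ℝ × (EuclideanSpace ℝ (Fin 3)) =>
      B p.1 p.2 * fderiv ℝ (F p.1) p.2 (eR p.2) * phiCut L T p.1 p.2) μT :=
    (hBm.aestronglyMeasurable.mul (hAE_DF heRm)).mul hφc.aestronglyMeasurable
  -- a bound for `∇F` on the compact `[0, T] × {r ≤ 2, |z| ≤ L}`
  have hKset : IsCompact (Icc (0 : ℝ) T ×ˢ solidCylinder 2 L) := isCompact_Icc.prod (isCompact_solidCylinder 2 L)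
  have hKsub : Icc (0 : ℝ) T ×ˢ solidCylinder 2 L ⊆ Iio τ' ×ˢ univ :=
    fun p hp => ⟨lt_of_le_of_lt hp.1.2 hTτ, mem_univ _⟩
  obtain ⟨K₁, hK₁⟩ := hKset.exists_bound_of_continuousOn (hP.continuousOn_fderiv.mono hKsub)
  set K : ℝ := max K₁ 0 with hK
  have hK0 : 0 ≤ K := le_max_right _ _
  have hKD : ∀ s ∈ Ioc (0 : ℝ) T, ∀ y ∈ solidCylinder 2 L, ‖fderiv ℝ (F s) y‖ ≤ K := fun s hs y hy =>
    (hK₁ (s, y) ⟨⟨hs.1.le, hs.2⟩, hy⟩).trans (le_max_left _ _)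
  have hA := hP.A_nonneg
  set D : ℝ × (EuclideanSpace ℝ (Fin 3)) → ℝ := fun p =>
    A * K * (solidCylinder 2 L).indicator (fun y => (cylRadius y)⁻¹) p.2 with hD
  have hDint : Integrable D μT := by
    have hg : Integrable (fun y : (EuclideanSpace ℝ (Fin 3)) => (solidCylinder 2 L).indicator (fun y => (cylRadius y)⁻¹) y) :=
      (integrableOn_inv_cylRadius_solidCylinder 2 L).integrable_indicator (measurableSet_solidCylinder 2 L)
    have hf : Integrable (fun _ : ℝ => A * K) (volume.restrict (Ioc (0 : ℝ) T)) :=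
      integrableOn_const (C := A * K) measure_Ioc_lt_top.ne
    exact hf.mul_prod hg
  -- pointwise bound for the extra-drift term on the cylinder
  have hBDle : ∀ p : ℝ × (EuclideanSpace ℝ (Fin 3)), p.1 ∈ Ioc (0 : ℝ) T → cylRadius p.2 ≠ 0 →
      p.2 ∈ solidCylinder 2 L →
      |B p.1 p.2 * fderiv ℝ (F p.1) p.2 (eR p.2)| ≤ A * K * (cylRadius p.2)⁻¹ := by
    intro p hs hr0 hy
    have hr : 0 < cylRadius p.2 := lt_of_le_of_ne (cylRadius_nonneg _) (Ne.symm hr0)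
    have hb : |B p.1 p.2| ≤ A * (cylRadius p.2)⁻¹ := by
      rw [← div_eq_mul_inv, le_div_iff₀ hr]; exact hP.beta_le_radial p.1 (hτ p.1 hs) p.2
    have hD' : |fderiv ℝ (F p.1) p.2 (eR p.2)| ≤ K := by
      rw [← Real.norm_eq_abs]
      exact ((fderiv ℝ (F p.1) p.2).le_opNorm _).trans
        ((mul_le_of_le_one_right (norm_nonneg _) (norm_eR_le_one _)).trans (hKD p.1 hs p.2 hy))
    rw [abs_mul]
    calc |B p.1 p.2| * |fderiv ℝ (F p.1) p.2 (eR p.2)| ≤ A * (cylRadius p.2)⁻¹ * K :=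
          mul_le_mul hb hD' (abs_nonneg _) (by positivity)
      _ = A * K * (cylRadius p.2)⁻¹ := by ring
  refine hDint.mono' hm5 (hae.mono fun p hp => ?_)
  obtain ⟨hs, hr0⟩ := hp
  by_cases hy : p.2 ∈ solidCylinder 2 L
  · simp only [hD, indicator_of_mem hy]
    rw [Real.norm_eq_abs, abs_mul]
    obtain ⟨φ0, φ1⟩ := phiCut_mem_Icc L T p.1 p.2
    have h1 := hBDle p hs hr0 hy
    have hri : 0 ≤ (cylRadius p.2)⁻¹ := inv_nonneg.2 (cylRadius_nonneg _)
    have h3 : |B p.1 p.2 * fderiv ℝ (F p.1) p.2 (eR p.2)| * |phiCut L T p.1 p.2| ≤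
        A * K * (cylRadius p.2)⁻¹ * 1 := by
      refine mul_le_mul h1 ?_ (abs_nonneg _) (by positivity)
      rw [abs_of_nonneg φ0]; exact φ1
    linarith
  · simp only [hD, indicator_of_notMem hy, mul_zero]
    rw [(phiCut_derivs_eq_zero_of_not_mem (T := T) (s := p.1) hy).1]
    simp

/-- **The space–time identity with source** (tree `IsKNSSSwirlPair.spaceTime_identity`, plus the extra-drift term): for a
sourced swirl triple on `s < τ'`, `0 ≤ T < τ'`, a constant `M` and the cut-off `φ = φ_{L,T}`, the inner space integrals of
`(F − M) ∂ₛφ`, `(F − M)(Dφ[V] + Δφ)`, `(2/r) F Dφ[e_r]`, `B ∂ᵣF φ` are integrable in time over `(0, T]` and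
`∫∫ (F − M)∂ₛφ + ∫∫ [(F − M)(Dφ[V] + Δφ) + (2/r) F φ_{,r} − B ∂ᵣF φ] = 0`. -/
theorem spaceTime_identity (hP : IsSourcedSwirl Cf Cu A τ' F V B) {L T : ℝ}
    (hT0 : 0 ≤ T) (hTτ : T < τ') (M : ℝ) :
    Integrable (fun s => ∫ y, (F s y - M) * (psiCut L y * deriv (zetaCut T) s))
      (volume.restrict (Ioc 0 T)) ∧
    Integrable (fun s => ∫ y, (F s y - M) *
      (fderiv ℝ (phiCut L T s) y (V s y) + (Δ (phiCut L T s)) y)) (volume.restrict (Ioc 0 T)) ∧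
    Integrable (fun s => ∫ y, 2 / cylRadius y * (F s y * fderiv ℝ (phiCut L T s) y (eR y)))
      (volume.restrict (Ioc 0 T)) ∧
    Integrable (fun s => ∫ y, B s y * fderiv ℝ (F s) y (eR y) * phiCut L T s y)
      (volume.restrict (Ioc 0 T)) ∧
    (∫ s in Ioc 0 T, ∫ y, (F s y - M) * (psiCut L y * deriv (zetaCut T) s)) +
      ∫ s in Ioc 0 T, ((∫ y, (F s y - M) *
        (fderiv ℝ (phiCut L T s) y (V s y) + (Δ (phiCut L T s)) y)) +
        (∫ y, 2 / cylRadius y * (F s y * fderiv ℝ (phiCut L T s) y (eR y))) -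
        ∫ y, B s y * fderiv ℝ (F s) y (eR y) * phiCut L T s y) = 0 := by
  have hτ : ∀ s ∈ Ioc (0 : ℝ) T, s < τ' := fun s hs => lt_of_le_of_lt hs.2 hTτ
  obtain ⟨hint1, hint2, hint3, hint40⟩ := spaceTime_integrable hP (L := L) hTτ M
  have hint5 := spaceTime_integrable_source hP (L := L) hTτ
  have hint4 : Integrable (fun p : ℝ × (EuclideanSpace ℝ (Fin 3)) =>
      (swirlEqnIntegrand F V p.1 p.2 - B p.1 p.2 * fderiv ℝ (F p.1) p.2 (eR p.2)) *
        phiCut L T p.1 p.2) ((volume.restrict (Ioc 0 T)).prod volume) := by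
    refine (hint40.sub hint5).congr (Eventually.of_forall fun p => ?_)
    simp only [Pi.sub_apply]; ring
  -- Fubini and the two identities
  refine ⟨hint1.integral_prod_left, hint2.integral_prod_left, hint3.integral_prod_left,
    hint5.integral_prod_left, ?_⟩
  have e1 : ∫ s in Ioc 0 T, ∫ y, (F s y - M) * (psiCut L y * deriv (zetaCut T) s) =
      ∫ y, ∫ s in Ioc 0 T, (F s y - M) * (psiCut L y * deriv (zetaCut T) s) :=
    integral_integral_swap (f := fun s y => (F s y - M) * (psiCut L y * deriv (zetaCut T) s)) hint1
  have e2 : ∀ᵐ y ∂(volume : Measure (EuclideanSpace ℝ (Fin 3))),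
      ∫ s in Ioc 0 T, (F s y - M) * (psiCut L y * deriv (zetaCut T) s) =
      -∫ s in Ioc 0 T, (swirlEqnIntegrand F V s y - B s y * fderiv ℝ (F s) y (eR y)) * phiCut L T s y := by
    filter_upwards [ae_cylRadius_ne_zero] with y hy
    rw [← intervalIntegral.integral_of_le hT0, ← intervalIntegral.integral_of_le hT0]
    exact time_identity hP hT0 hTτ M hy
  have e3 : ∫ s in Ioc 0 T, ∫ y, (swirlEqnIntegrand F V s y - B s y * fderiv ℝ (F s) y (eR y)) *
      phiCut L T s y =
      ∫ y, ∫ s in Ioc 0 T, (swirlEqnIntegrand F V s y - B s y * fderiv ℝ (F s) y (eR y)) *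
        phiCut L T s y :=
    integral_integral_swap (f := fun s y =>
      (swirlEqnIntegrand F V s y - B s y * fderiv ℝ (F s) y (eR y)) * phiCut L T s y) hint4
  have e4 : ∫ s in Ioc 0 T, ∫ y, (swirlEqnIntegrand F V s y - B s y * fderiv ℝ (F s) y (eR y)) *
      phiCut L T s y =
      ∫ s in Ioc 0 T, ((∫ y, (F s y - M) *
        (fderiv ℝ (phiCut L T s) y (V s y) + (Δ (phiCut L T s)) y)) +
        (∫ y, 2 / cylRadius y * (F s y * fderiv ℝ (phiCut L T s) y (eR y))) -
        ∫ y, B s y * fderiv ℝ (F s) y (eR y) * phiCut L T s y) := by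
    refine setIntegral_congr_fun measurableSet_Ioc fun s hs => ?_
    have h := slice_identity hP (hτ s hs) L T M
    obtain ⟨-, hsplit⟩ := integral_sourced_slice hP (hτ s hs) L T
    simp only [swirlEqnIntegrand] at h hsplit ⊢
    rw [hsplit, ← h]
  rw [← e4, e1, integral_congr_ae e2, integral_neg, ← e3]
  ring

end IsSourcedSwirl

end Summit.NavierStokesRegularity.NavierStokesRegularity.Theorems.HalfSpaceWindowDoorCirculationCarryingRigiditySourcedSwirlIdentity

end
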